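import Summits.BirchSwinnertonDyer.Rank1Residual.P2.CongruentNumberSilentEvenFiveEnclosureMonskyEven
import Summits.BirchSwinnertonDyer.Rank1Residual.P2.CongruentNumberPairsAtTwoEvenRungTwo
import HarnessLib

/-!
# Cell «bsd-monsky» (typer): THE `k = 2` RUNG OF THE UNIFORM EVEN MONSKY LAW C-P2-2 FROM THE 𝒮⁻ ENCLOSURE —
# `CongruentSilentEvenBSDTwoAt 2` relative to {`hR`, `hMe`, `hSys′`} and `CongruentEvenBSDTwoAt 2` /
# `CongruentEvenOrdTwoAt 2` relative to {U⁺, GZK, `hMe`, `hR`, `hSys′`}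

HONEST FRAMING: nothing asserted; every theorem is conditional on displayed named facts (`hMe` = Heath-Brown 1994,
Appendix (Monsky), even case, printed as a sketch proof, pp. 368–369; `hR` = Rédei–Reichardt; `hSys′` = Tian's
CM-point system on `𝒮⁻` with its printed properties, `Tian2014.tian2014_system_sMinus_genus`; `hU` = TYZ Thm. 1.2
in its `ρ`-free form U⁺, the binder of DOOR B6, verbatim; `hGZK`). The rung bookkeeping is the sub-lane's landed
`P2/CongruentNumberPairsAtTwoEvenRungTwo.lean` (C-P2-1 ⟺ rung two, modulo {U⁺, GZK, `hMe`, `hR`}; the silent rung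
modulo `hR` alone); the 𝒮⁻ theorem is the cell's landed enclosure (`…EnclosureMonskyEven.lean`, p403317; the route-B
compositions follow in `…ThetaDescentRungTwo.lean` once `…ThetaDescentRank.lean` (p403392) is built). This file only COMPOSES the two: under the ruled quantifier `2 ≤ k` of the
typed law (`Conjectures.CongruentEvenMonskyBSDTwo`, p363094) its first rung is now a theorem of the tree relative
to the named facts above — every cell `n = 2p₁p₂ ≡ 6 (mod 8)` with Monsky's even Selmer rank `s(n) = 1`, silent
(`Σ₂′(n)` even: exactly `𝒮⁻`, the enclosure) or loud (`Σ₂′(n)` odd: DOOR B6 over census vocabulary). The rungs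
`k ≥ 3` are NOT touched (README §3). Nothing booked.
References: HOME `lean/PLAN.md` v0.8; `P2/Conjectures/CongruentNumberEvenMonskyLawAtTwo.lean` §1, §4.
-/

noncomputable section

open scoped Classical

open WeierstrassCurve NumberField Literature.NumberTheory.EllipticCurves
  Literature.NumberTheory.EllipticCurves.Rank1Residual
  Literature.NumberTheory.EllipticCurves.Rank1Residual.Typed
  Literature.NumberTheory.EllipticCurves.TianYuanZhang2017
  Literature.NumberTheory.EllipticCurves.HeathBrown1994
  Literature.NumberTheory.EllipticCurves.Tian2014
  Literature.NumberTheory.QuadraticFields.RedeiReichardt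

set_option autoImplicit false

namespace Summit.BirchSwinnertonDyer.Rank1Residual.P2

open Conjectures

/-! ## §1 Route A (the system fact): the silent rung modulo {`hR`, `hMe`, `hSys′`}, the whole rung modulo
{U⁺, GZK, `hMe`, `hR`, `hSys′`} -/

/-- **THE SILENT `k = 2` RUNG `CongruentSilentEvenBSDTwoAt 2` of C-P2-2 from the 𝒮⁻ enclosure** — modulo
Rédei–Reichardt (`hR`: `𝒮⁻` is exactly the silent `s = 1` cell at `k = 2`), Monsky's even matrix (`hMe`) and the
system fact (`hSys′`); no U⁺, no GZK, no Cor 5.15. Conditional; nothing asserted.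
[cite: Monsky1990MockHeegner, Remark (3) (p. 67)] [cite: TianYuanZhang2017, Thm. 1.2, Thm. 3.3]
[cite: HeathBrown1994SelmerCongruentII, Appendix (Monsky)] [cite: Tian2014, Thm. 2.8 (J132), Notations (J122–123)] -/
theorem congruentSilentEvenBSDTwoAt_two_of_genusSystem_of_monskyEven
    (hR : redeiReichardt_fourTwoCard_classGroup) (hMe : monsky_card_selmerGroup_two_even)
    (hSys : tian2014_system_sMinus_genus) : CongruentSilentEvenBSDTwoAt 2 :=
  congruentSilentEvenBSDTwoAt_two_of_congruentSilentEvenFiveBSDTwo hR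
    (congruentSilentEvenFiveBSDTwo_of_genusSystem_of_monskyEven hMe hSys)

/-- **THE `k = 2` RUNG `CongruentEvenBSDTwoAt 2` of C-P2-2 from the 𝒮⁻ enclosure** — every cell `n = 2p₁p₂ ≡ 6 (mod 8)`
with `s(n) = 1` has `ord_{s=1} L(E_n, s) = 1` and `BSD(E_n, 2)`: the silent cells by the enclosure, the loud cells by
DOOR B6 over census vocabulary (`Conjectures.congruentEvenBSDTwoAt_of_silent`). Modulo {U⁺ `hU`, GZK, `hMe`, `hR`, `hSys′`}.
Conditional; nothing asserted. [cite: Monsky1990MockHeegner, Remark (3) (p. 67)] [cite: TianYuanZhang2017, Thm. 1.2, Thm. 3.3, Thm. 3.5]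
[cite: HeathBrown1994SelmerCongruentII, Appendix (Monsky)] [cite: Miller2011LMS, Def. 1.1 (arXiv:1010.2431 p. 3)] -/
theorem congruentEvenBSDTwoAt_two_of_genusSystem_of_monskyEven
    (hU : ∀ (n : ℕ), Squarefree n → (n % 8 = 5 ∨ n % 8 = 6 ∨ n % 8 = 7) →
      ∃ L : ℤ, IsScriptL n L ∧
        ((n % 8 = 5 ∨ n % 8 = 7) → (2 : ℤ) ∣ L →
          Even (genusSum₁ n fun d => genusClassNumber (GenusField d)) ∧
          Even (genusSum₂' n fun d => genusClassNumber (GenusField d))) ∧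
        (n % 8 = 6 → (2 : ℤ) ∣ L → Even (genusSum₂' n fun d => genusClassNumber (GenusField d))))
    (hGZK : rank_eq_analyticRank_of_analyticRank_le_one) (hMe : monsky_card_selmerGroup_two_even)
    (hR : redeiReichardt_fourTwoCard_classGroup) (hSys : tian2014_system_sMinus_genus) :
    CongruentEvenBSDTwoAt 2 :=
  congruentEvenBSDTwoAt_two_of_congruentSilentEvenFiveBSDTwo hU hGZK hMe hR
    (congruentSilentEvenFiveBSDTwo_of_genusSystem_of_monskyEven hMe hSys)

/-- **THE `k = 2` RUNG, SHARPER FORM `CongruentEvenOrdTwoAt 2`** (`L′(E_n, 1) = x·Ω·Reg`, `ord₂ x = 2`) from the 𝒮⁻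
enclosure, through the law file's `congruentEvenOrdTwoAt_of_bsdTwoAt`. Modulo {U⁺, GZK, `hMe`, `hR`, `hSys′`}.
Conditional; nothing asserted. [cite: Monsky1990MockHeegner, Remark (3) (p. 67)] [cite: TianYuanZhang2017, §1 (1.1), Thm. 3.3] -/
theorem congruentEvenOrdTwoAt_two_of_genusSystem_of_monskyEven
    (hU : ∀ (n : ℕ), Squarefree n → (n % 8 = 5 ∨ n % 8 = 6 ∨ n % 8 = 7) →
      ∃ L : ℤ, IsScriptL n L ∧
        ((n % 8 = 5 ∨ n % 8 = 7) → (2 : ℤ) ∣ L →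
          Even (genusSum₁ n fun d => genusClassNumber (GenusField d)) ∧
          Even (genusSum₂' n fun d => genusClassNumber (GenusField d))) ∧
        (n % 8 = 6 → (2 : ℤ) ∣ L → Even (genusSum₂' n fun d => genusClassNumber (GenusField d))))
    (hGZK : rank_eq_analyticRank_of_analyticRank_le_one) (hMe : monsky_card_selmerGroup_two_even)
    (hR : redeiReichardt_fourTwoCard_classGroup) (hSys : tian2014_system_sMinus_genus) :
    CongruentEvenOrdTwoAt 2 :=
  congruentEvenOrdTwoAt_of_bsdTwoAt hGZK hMe
    (congruentEvenBSDTwoAt_two_of_genusSystem_of_monskyEven hU hGZK hMe hR hSys)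

end Summit.BirchSwinnertonDyer.Rank1Residual.P2

end
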